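import Summits.RiemannHypothesis.RiemannHypothesis.Theorems.WeilColumnThetaPrimeSide
import HarnessLib

/-!
# THETA certificate, tier 2, D6′: the PRIME SIDE of the odd tail with the counter-moving overlap kept as a CONVOLUTION (RH-FREE)

Cell `rh-explicit`, WEIL column, seat weil-1 gen21 (cc-s2-1 gen22 TIER2-KERNEL-SPEC §2 «Cross term (E4/E5)», §3, §5 (K4)). Tier 1's
`ThetaPrime.norm_weilConv_weilReflect_oddTail_le` bounds the autocorrelation `k = g ⋆ g̃` of the odd tail `g = T − T(−·)` by
`E²e^{−κt}/κ + E²·w₊·e^{−κw}` (`w = t + 2x₁`), the second summand being the counter-moving overlap `V_T(−t)` under the EXPONENTIAL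
envelope. Tier 2 keeps that overlap as a convolution of a finer envelope: with `‖T(x₁ − s)‖ ≤ E_c·e(s)` (`s ≥ 0`, `e ≥ 0` continuous)
and any `Ve` with `∫_0^w e(s)e(w − s) ds ≤ Ve(w)` (`w ≥ 0`), `Ve ≥ 0`:

* `norm_weilConv_weilReflect_oddTail_le_cell`: **`‖k(t)‖ ≤ E²e^{−κt}/κ + E_c²·Ve(t + 2x₁)`** (`t ≥ 0`);
* `norm_weilPrimeTerm_le_of_oddTail_cell` (`κ = m + ½`): **`‖weilPrimeTerm k‖ ≤ (2E²/(m+½))·S₁ + 2E_c²·X`** whenever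
  `Σ_{n<K} Λ(n)/n^{m+1} ≤ S₁` and `Σ_{n<K} Λ(n)/√n·Ve(log n + 2x₁) ≤ X` for all `K` — the `primesC` and `cross` lets of the tier-2 kernel
  once E4 (`integral_mul_sub_le_lagCellSum`) and E5 supply `X` (sequel `WeilColumnThetaCrossTermT2`).

No measurability of `T` is used. Nothing here bears on the truth of RH.
-/

noncomputable section

set_option linter.dupNamespace false

open Complex Set MeasureTheory Filter
open scoped Real Topology ComplexConjugate

namespace Summit.RiemannHypothesis.RiemannHypothesis.Theorems.WeilColumn.ThetaPrime

open Literature.NumberTheory.LFunctions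

variable {T g : ℝ → ℂ} {E Ec κ x₁ : ℝ} {e Ve : ℝ → ℝ}

/-! ## §1 The autocorrelation of the odd tail: co-moving part exponential, counter-moving part a convolution of `e` -/

/-- **The tier-2 kernel bound** (THETA-CERT-cc6 §E4: `|k_T(t)| ≤ 2|C_T(t)| + |V_T(−t)|`): for `x₁ < 0`, `κ > 0`, `E, E_c ≥ 0`, `T` vanishing
beyond `x₁` with `‖T u‖ ≤ Ee^{κ(u−x₁)}` (`u ≤ x₁`) and `‖T(x₁ − s)‖ ≤ E_c·e(s)` (`s ≥ 0`, `e ≥ 0` continuous), any `Ve ≥ 0` with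
`∫_0^w e(s)e(w−s) ds ≤ Ve(w)` for `w ≥ 0`, any `g` with `g(u) = T(u) − T(−u)`, and `t ≥ 0`:
`‖(g ⋆ g̃)(t)‖ ≤ E²e^{−κt}/κ + E_c²·Ve(t + 2x₁)`. [THETA-CERT-cc6 §D6/§E4; TIER2-KERNEL-SPEC §2] -/
theorem norm_weilConv_weilReflect_oddTail_le_cell (hx₁ : x₁ < 0) (hκ : 0 < κ) (hE : 0 ≤ E) (hEc : 0 ≤ Ec)
    (hT0 : ∀ u, x₁ < u → T u = 0) (hTE : ∀ u, u ≤ x₁ → ‖T u‖ ≤ E * Real.exp (κ * (u - x₁)))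
    (hec : Continuous e) (he0 : ∀ s, 0 ≤ e s) (hTe : ∀ s, 0 ≤ s → ‖T (x₁ - s)‖ ≤ Ec * e s)
    (hVe0 : ∀ w, 0 ≤ Ve w) (hVe : ∀ w, 0 ≤ w → ∫ s in (0 : ℝ)..w, e s * e (w - s) ≤ Ve w)
    (hg : ∀ u, g u = T u - T (-u)) {t : ℝ} (ht : 0 ≤ t) :
    ‖weilConv g (weilReflect g) t‖ ≤ E ^ 2 * Real.exp (-κ * t) / κ + Ec ^ 2 * Ve (t + 2 * x₁) := by
  -- the three majorants
  set m₁ : ℝ → ℝ := (Iic x₁).indicator fun u ↦ E ^ 2 * Real.exp (-κ * t) * Real.exp (2 * κ * (u - x₁)) with hm₁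
  set m₂ : ℝ → ℝ := (Ici (t - x₁)).indicator fun u ↦ E ^ 2 * Real.exp (κ * (t - 2 * x₁)) * Real.exp (-(2 * κ) * u)
    with hm₂
  set m₄ : ℝ → ℝ := (Icc (-x₁) (t + x₁)).indicator fun u ↦ Ec ^ 2 * (e (u + x₁) * e (t + x₁ - u)) with hm₄
  have hm₁0 : ∀ u, 0 ≤ m₁ u := fun u ↦ by rw [hm₁]; exact indicator_nonneg (fun _ _ ↦ by positivity) u
  have hm₂0 : ∀ u, 0 ≤ m₂ u := fun u ↦ by rw [hm₂]; exact indicator_nonneg (fun _ _ ↦ by positivity) u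
  have hm₄0 : ∀ u, 0 ≤ m₄ u := fun u ↦ by
    rw [hm₄]; exact indicator_nonneg (fun _ _ ↦ mul_nonneg (sq_nonneg _) (mul_nonneg (he0 _) (he0 _))) u
  -- integrability and the integrals of the two exponential majorants (as in tier 1)
  have hi₁ : Integrable m₁ := by
    rw [hm₁]
    refine IntegrableOn.integrable_indicator ?_ measurableSet_Iic
    have : (fun u : ℝ ↦ E ^ 2 * Real.exp (-κ * t) * Real.exp (2 * κ * (u - x₁))) =
        fun u : ℝ ↦ (E ^ 2 * Real.exp (-κ * t) * Real.exp (-(2 * κ * x₁))) * Real.exp ((2 * κ) * u) := by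
      funext u; rw [mul_sub, sub_eq_add_neg, Real.exp_add]; ring
    rw [this]
    exact (integrableOn_exp_mul_Iic (by positivity) x₁).const_mul _
  have hv₁ : ∫ u, m₁ u = E ^ 2 * Real.exp (-κ * t) / (2 * κ) := by
    rw [hm₁, integral_indicator measurableSet_Iic]
    have : (fun u : ℝ ↦ E ^ 2 * Real.exp (-κ * t) * Real.exp (2 * κ * (u - x₁))) =
        fun u : ℝ ↦ (E ^ 2 * Real.exp (-κ * t) * Real.exp (-(2 * κ * x₁))) * Real.exp ((2 * κ) * u) := by
      funext u; rw [mul_sub, sub_eq_add_neg, Real.exp_add]; ring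
    rw [this, integral_const_mul, integral_exp_mul_Iic (by positivity) x₁]
    have e1 : Real.exp (-(2 * κ * x₁)) * Real.exp (2 * κ * x₁) = 1 := by
      rw [← Real.exp_add, neg_add_cancel, Real.exp_zero]
    rw [mul_div_assoc', mul_assoc, e1, mul_one]
  have hi₂ : Integrable m₂ := by
    rw [hm₂]
    refine IntegrableOn.integrable_indicator ?_ measurableSet_Ici
    rw [integrableOn_Ici_iff_integrableOn_Ioi]
    exact (exp_neg_integrableOn_Ioi (t - x₁) (by positivity : 0 < 2 * κ)).const_mul _
  have hv₂ : ∫ u, m₂ u = E ^ 2 * Real.exp (-κ * t) / (2 * κ) := by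
    rw [hm₂, integral_indicator measurableSet_Ici, integral_Ici_eq_integral_Ioi, integral_const_mul,
      integral_exp_mul_Ioi (by linarith) (t - x₁), neg_div_neg_eq]
    have e1 : Real.exp (κ * (t - 2 * x₁)) * Real.exp (-(2 * κ) * (t - x₁)) = Real.exp (-κ * t) := by
      rw [← Real.exp_add]; congr 1; ring
    rw [mul_div_assoc', mul_assoc, e1]
  -- the counter-moving majorant: continuous on a compact window
  have hcont₄ : Continuous fun u : ℝ ↦ Ec ^ 2 * (e (u + x₁) * e (t + x₁ - u)) :=
    continuous_const.mul ((hec.comp (continuous_id.add continuous_const)).mul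
      (hec.comp (continuous_const.sub continuous_id)))
  have hi₄ : Integrable m₄ := by
    rw [hm₄]
    exact (hcont₄.integrableOn_Icc (a := -x₁) (b := t + x₁)).integrable_indicator measurableSet_Icc
  have hv₄ : ∫ u, m₄ u ≤ Ec ^ 2 * Ve (t + 2 * x₁) := by
    rcases lt_or_ge (t + 2 * x₁) 0 with hw | hw
    · -- empty window
      have hempty : Icc (-x₁) (t + x₁) = ∅ := Icc_eq_empty (by linarith)
      rw [hm₄, hempty, indicator_empty]
      simp only [integral_zero]
      exact mul_nonneg (sq_nonneg _) (hVe0 _)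
    · have hle : -x₁ ≤ t + x₁ := by linarith
      rw [hm₄, integral_indicator measurableSet_Icc, integral_Icc_eq_integral_Ioc,
        ← intervalIntegral.integral_of_le hle, intervalIntegral.integral_const_mul]
      refine mul_le_mul_of_nonneg_left ?_ (sq_nonneg _)
      -- substitute `s = u + x₁`
      have hsub : ∫ u in (-x₁)..(t + x₁), e (u + x₁) * e (t + x₁ - u) =
          ∫ s in (0 : ℝ)..(t + 2 * x₁), e s * e (t + 2 * x₁ - s) := by
        have h := intervalIntegral.integral_comp_add_right (fun s ↦ e s * e (t + 2 * x₁ - s)) (a := -x₁) (b := t + x₁) x₁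
        rw [show -x₁ + x₁ = 0 by ring, show t + x₁ + x₁ = t + 2 * x₁ by ring] at h
        rw [← h]
        refine intervalIntegral.integral_congr fun u _ ↦ ?_
        show e (u + x₁) * e (t + x₁ - u) = e (u + x₁) * e (t + 2 * x₁ - (u + x₁))
        congr 2; ring
      rw [hsub]
      exact hVe _ hw
  -- pointwise: `‖g u‖‖g(u−t)‖ ≤ m₁ u + m₂ u + m₄ u`
  have hpt : ∀ u : ℝ, ‖g u‖ * ‖g (u - t)‖ ≤ m₁ u + m₂ u + m₄ u := by
    intro u
    rw [hg u, hg (u - t), show -(u - t) = t - u by ring]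
    by_cases hu : u ≤ x₁
    · -- left: T(u)·T(u−t)
      have h1 := norm_odd_le_left hx₁ hT0 hTE hu
      have h2 : ‖T (u - t) - T (t - u)‖ ≤ E * Real.exp (κ * (u - t - x₁)) := by
        have := norm_odd_le_left hx₁ hT0 hTE (show u - t ≤ x₁ by linarith)
        rwa [show -(u - t) = t - u by ring] at this
      have hval : m₁ u = E ^ 2 * Real.exp (-κ * t) * Real.exp (2 * κ * (u - x₁)) := by
        rw [hm₁, indicator_of_mem (show u ∈ Iic x₁ from hu)]
      have hprod : E * Real.exp (κ * (u - x₁)) * (E * Real.exp (κ * (u - t - x₁))) =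
          E ^ 2 * Real.exp (-κ * t) * Real.exp (2 * κ * (u - x₁)) := by
        have e1 : Real.exp (κ * (u - x₁)) * Real.exp (κ * (u - t - x₁)) =
            Real.exp (-κ * t) * Real.exp (2 * κ * (u - x₁)) := by
          rw [← Real.exp_add, ← Real.exp_add]; congr 1; ring
        linear_combination (E ^ 2) * e1
      calc ‖T u - T (-u)‖ * ‖T (u - t) - T (t - u)‖
          ≤ E * Real.exp (κ * (u - x₁)) * (E * Real.exp (κ * (u - t - x₁))) :=
            mul_le_mul h1 h2 (norm_nonneg _) (by positivity)
        _ = m₁ u := by rw [hprod, hval]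
        _ ≤ m₁ u + m₂ u + m₄ u := by linarith [hm₂0 u, hm₄0 u]
    · have hu' : x₁ < u := lt_of_not_ge hu
      by_cases hu2 : u < -x₁
      · rw [odd_eq_zero_mid hT0 hu' hu2, norm_zero, zero_mul]
        linarith [hm₁0 u, hm₂0 u, hm₄0 u]
      · have hu2' : -x₁ ≤ u := le_of_not_gt hu2
        by_cases hα : u ≤ t + x₁
        · -- (α): T(−u)·T(u−t) under the FINE envelope `e`
          have h1 : ‖T u - T (-u)‖ ≤ Ec * e (u + x₁) := by
            rw [hT0 u (by linarith), zero_sub, norm_neg, show -u = x₁ - (u + x₁) by ring]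
            exact hTe _ (by linarith)
          have h2 : ‖T (u - t) - T (t - u)‖ ≤ Ec * e (t + x₁ - u) := by
            rw [hT0 (t - u) (by linarith), sub_zero, show u - t = x₁ - (t + x₁ - u) by ring]
            exact hTe _ (by linarith)
          have hval : m₄ u = Ec ^ 2 * (e (u + x₁) * e (t + x₁ - u)) := by
            rw [hm₄, indicator_of_mem (show u ∈ Icc (-x₁) (t + x₁) from ⟨hu2', hα⟩)]
          calc ‖T u - T (-u)‖ * ‖T (u - t) - T (t - u)‖
              ≤ Ec * e (u + x₁) * (Ec * e (t + x₁ - u)) :=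
                mul_le_mul h1 h2 (norm_nonneg _) (mul_nonneg hEc (he0 _))
            _ = m₄ u := by rw [hval]; ring
            _ ≤ m₁ u + m₂ u + m₄ u := by linarith [hm₁0 u, hm₂0 u]
        · have hα' : t + x₁ < u := lt_of_not_ge hα
          by_cases hγ : t - x₁ ≤ u
          · -- (γ): T(−u)·T(t−u)
            have h1 := norm_odd_le_right hx₁ hT0 hTE hu2'
            have h2 : ‖T (u - t) - T (t - u)‖ ≤ E * Real.exp (κ * (t - u - x₁)) := by
              have := norm_odd_le_right hx₁ hT0 hTE (show -x₁ ≤ u - t by linarith)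
              rwa [show -(u - t) = t - u by ring] at this
            have hval : m₂ u = E ^ 2 * Real.exp (κ * (t - 2 * x₁)) * Real.exp (-(2 * κ) * u) := by
              rw [hm₂, indicator_of_mem (show u ∈ Ici (t - x₁) from hγ)]
            have hprod : E * Real.exp (κ * (-u - x₁)) * (E * Real.exp (κ * (t - u - x₁))) =
                E ^ 2 * Real.exp (κ * (t - 2 * x₁)) * Real.exp (-(2 * κ) * u) := by
              have e1 : Real.exp (κ * (-u - x₁)) * Real.exp (κ * (t - u - x₁)) =
                  Real.exp (κ * (t - 2 * x₁)) * Real.exp (-(2 * κ) * u) := by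
                rw [← Real.exp_add, ← Real.exp_add]; congr 1; ring
              linear_combination (E ^ 2) * e1
            calc ‖T u - T (-u)‖ * ‖T (u - t) - T (t - u)‖
                ≤ E * Real.exp (κ * (-u - x₁)) * (E * Real.exp (κ * (t - u - x₁))) :=
                  mul_le_mul h1 h2 (norm_nonneg _) (by positivity)
              _ = m₂ u := by rw [hprod, hval]
              _ ≤ m₁ u + m₂ u + m₄ u := by linarith [hm₁0 u, hm₄0 u]
          · -- (β): both factors of `g(u − t)` vanish
            have hz : T (u - t) - T (t - u) = 0 := by
              rw [hT0 (u - t) (by linarith), hT0 (t - u) (by linarith [lt_of_not_ge hγ]), sub_zero]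
            rw [hz, norm_zero, mul_zero]
            linarith [hm₁0 u, hm₂0 u, hm₄0 u]
  -- integrate
  have hk : ‖weilConv g (weilReflect g) t‖ ≤ ∫ u, ‖g u‖ * ‖g (u - t)‖ := by
    rw [weilConv_apply]
    refine (norm_integral_le_integral_norm _).trans (le_of_eq ?_)
    congr 1 with u
    rw [norm_mul, weilReflect, Complex.norm_conj, show -(t - u) = u - t by ring]
  have hmono : ∫ u, ‖g u‖ * ‖g (u - t)‖ ≤ ∫ u, (m₁ u + m₂ u + m₄ u) :=
    integral_mono_of_nonneg (Eventually.of_forall fun u ↦ by positivity) ((hi₁.add hi₂).add hi₄)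
      (Eventually.of_forall hpt)
  have hi12 : Integrable (fun u ↦ m₁ u + m₂ u) := hi₁.add hi₂
  have hsum : ∫ u, (m₁ u + m₂ u + m₄ u) ≤ E ^ 2 * Real.exp (-κ * t) / κ + Ec ^ 2 * Ve (t + 2 * x₁) := by
    rw [integral_add hi12 hi₄, integral_add hi₁ hi₂, hv₁, hv₂]
    have hκ0' : κ ≠ 0 := hκ.ne'
    have e12 : E ^ 2 * Real.exp (-κ * t) / (2 * κ) + E ^ 2 * Real.exp (-κ * t) / (2 * κ) = E ^ 2 * Real.exp (-κ * t) / κ := by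
      field_simp; ring
    rw [e12]
    linarith [hv₄]
  exact hk.trans (hmono.trans hsum)

/-! ## §2 The prime term with the counter-moving part kept -/

/-- **D6′, the prime side in the tier-2 kernel's currency.** Let `x₁ < 0`, `m ≥ 1`, `E, E_c ≥ 0`, `T` vanish beyond `x₁` with
`‖T u‖ ≤ Ee^{(m+½)(u−x₁)}` (`u ≤ x₁`) and `‖T(x₁ − s)‖ ≤ E_c·e(s)` (`s ≥ 0`, `e ≥ 0` continuous), `Ve ≥ 0` with `∫_0^w e(s)e(w−s)ds ≤ Ve(w)`
(`w ≥ 0`); let `g` be a Weil test function supported in `[−a, a]` with `g(u) = T(u) − T(−u)`. If `Σ_{n<K} Λ(n)/n^{m+1} ≤ S₁` and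
`Σ_{n<K} Λ(n)/√n·Ve(log n + 2x₁) ≤ X` for every `K`, then `‖weilPrimeTerm (g ⋆ g̃)‖ ≤ (2E²/(m+½))·S₁ + 2E_c²·X`.
[THETA-CERT-cc6 §D6/§E4; TIER2-KERNEL-SPEC §2/§5] -/
theorem norm_weilPrimeTerm_le_of_oddTail_cell {m : ℕ} (hx₁ : x₁ < 0) (hE : 0 ≤ E) (hEc : 0 ≤ Ec)
    (hT0 : ∀ u, x₁ < u → T u = 0)
    (hTE : ∀ u, u ≤ x₁ → ‖T u‖ ≤ E * Real.exp (((m : ℝ) + 1 / 2) * (u - x₁)))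
    (hec : Continuous e) (he0 : ∀ s, 0 ≤ e s) (hTe : ∀ s, 0 ≤ s → ‖T (x₁ - s)‖ ≤ Ec * e s)
    (hVe0 : ∀ w, 0 ≤ Ve w) (hVe : ∀ w, 0 ≤ w → ∫ s in (0 : ℝ)..w, e s * e (w - s) ≤ Ve w)
    (hgt : IsWeilTest g) {a : ℝ} (hsupp : tsupport g ⊆ Icc (-a) a) (hg : ∀ u, g u = T u - T (-u))
    {S₁ X : ℝ}
    (hS₁ : ∀ K : ℕ, ∑ n ∈ Finset.range K, (ArithmeticFunction.vonMangoldt n : ℝ) / (n : ℝ) ^ (m + 1) ≤ S₁)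
    (hX : ∀ K : ℕ, ∑ n ∈ Finset.range K, (ArithmeticFunction.vonMangoldt n : ℝ) / Real.sqrt n *
      Ve (Real.log n + 2 * x₁) ≤ X) :
    ‖weilPrimeTerm (weilConv g (weilReflect g))‖ ≤ 2 * E ^ 2 / ((m : ℝ) + 1 / 2) * S₁ + 2 * Ec ^ 2 * X := by
  set k : ℝ → ℂ := weilConv g (weilReflect g) with hk
  set κ : ℝ := (m : ℝ) + 1 / 2 with hκ
  have hκ0 : 0 < κ := by rw [hκ]; positivity
  have hkz : ∀ u : ℝ, 2 * a < |u| → k u = 0 := fun u hu ↦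
    weilConv_weilReflect_eq_zero_of_le_abs hgt hsupp hu.le
  rw [WeilContinuous.weilPrimeTerm_eq_sum_of_support hkz]
  set K : ℕ := ⌈Real.exp (2 * a + 1)⌉₊ with hK
  have hterm : ∀ n ∈ Finset.range K,
      ‖((ArithmeticFunction.vonMangoldt n : ℝ) : ℂ) / (Real.sqrt n : ℂ) * (k (Real.log n) + k (-Real.log n))‖ ≤
        2 * E ^ 2 / κ * ((ArithmeticFunction.vonMangoldt n : ℝ) / (n : ℝ) ^ (m + 1)) +
          2 * Ec ^ 2 * ((ArithmeticFunction.vonMangoldt n : ℝ) / Real.sqrt n * Ve (Real.log n + 2 * x₁)) := by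
    intro n _
    rcases Nat.eq_zero_or_pos n with h0 | hn
    · subst h0; simp
    have hn1 : 1 ≤ n := hn
    have hΛ : 0 ≤ (ArithmeticFunction.vonMangoldt n : ℝ) := ArithmeticFunction.vonMangoldt_nonneg
    have hlog : 0 ≤ Real.log n := Real.log_natCast_nonneg n
    have hkb := norm_weilConv_weilReflect_oddTail_le_cell hx₁ hκ0 hE hEc hT0 (by simpa [hκ] using hTE) hec he0 hTe hVe0 hVe
      hg hlog
    have h2 := norm_weilConv_weilReflect_add_neg_le g (Real.log n)
    have hw := (weights_at_log (m := m) hn1 x₁).1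
    rw [norm_mul, norm_div, Complex.norm_real, Complex.norm_real, Real.norm_of_nonneg hΛ,
      Real.norm_of_nonneg (Real.sqrt_nonneg _)]
    have hsq0 : 0 < Real.sqrt n := Real.sqrt_pos.2 (by exact_mod_cast hn)
    calc (ArithmeticFunction.vonMangoldt n : ℝ) / Real.sqrt n * ‖k (Real.log n) + k (-Real.log n)‖
        ≤ (ArithmeticFunction.vonMangoldt n : ℝ) / Real.sqrt n *
            (2 * (E ^ 2 * Real.exp (-κ * Real.log n) / κ + Ec ^ 2 * Ve (Real.log n + 2 * x₁))) :=
          mul_le_mul_of_nonneg_left (h2.trans (by linarith [hkb])) (div_nonneg hΛ hsq0.le)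
      _ = 2 * E ^ 2 / κ * ((ArithmeticFunction.vonMangoldt n : ℝ) *
              ((1 / Real.sqrt n) * Real.exp (-κ * Real.log n))) +
            2 * Ec ^ 2 * ((ArithmeticFunction.vonMangoldt n : ℝ) / Real.sqrt n * Ve (Real.log n + 2 * x₁)) := by
          field_simp
      _ = _ := by rw [hκ, hw]; ring
  refine (norm_sum_le _ _).trans ((Finset.sum_le_sum hterm).trans ?_)
  rw [Finset.sum_add_distrib, ← Finset.mul_sum, ← Finset.mul_sum]
  have hE2 : 0 ≤ 2 * E ^ 2 / κ := by positivity
  have hE3 : 0 ≤ 2 * Ec ^ 2 := by positivity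
  exact add_le_add (mul_le_mul_of_nonneg_left (hS₁ K) hE2) (mul_le_mul_of_nonneg_left (hX K) hE3)

end Summit.RiemannHypothesis.RiemannHypothesis.Theorems.WeilColumn.ThetaPrime

end
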